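/-
Copyright (c) 2026 the pub-hodgecm-mathlib formalisation cell (harness21).  R90-TF SLAB, section S10 (Rogawski 1990, §13.6–13.8 read at `v`),
prover R90-C138-p08 (g2) — KEYSTONE BRICK «D §3+§5 in body currency» (offer (ii) of R90-C138-p07 (g2) for DEAL #37′ `sock₂Sig_of_inputs`);
h413 = `stmt-HodgeConjecture-24833`, route `HCCMUnconditional`.
-/
import Summits.HodgeConjecture.HodgeConjecture.Theorems.R90S10UnrHatPinsOfRestricted   -- ★ p862102 `unrHatPins_of_restricted` (the five (D3-pins) on the e.v.p. currency)
import Literature.Topology.SummableDiracCombSeparation                                -- ★ `Literature.Topology.separation_of_injective_bounded_starClosed` (Langlands separation, PROVED)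
import HarnessLib

/-!
# R90-TF ∕ S10 — THE STABILISED IDENTITY AT THE E.V.P. FROM THE TRACE-FORMULA BLOCKS, IN BODY CURRENCY
# (`Theorems/R90S10StabilisedAtEvpOfPartsBodies.lean`; ns `Summit.HodgeConjecture.HodgeConjecture.R90.S10`; theorems only — no `def`, no instance, no notation, no `sorry`;
# LAW L9: a `Theorems` file imports ★ `Theorems` ∕ `Literature` ∕ `Mathlib` only)

Print: [Rogawski1990] §13.8, proof of Prop. 13.8.3, display (13.8.3) p. 218 L5–7 («… where the sum is over cuspidal `π` on `G` such that `ψ_G(t(π)) = t`»);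
§13.7 pp. 210–211 (the lines (1)–(8), (1′)–(3′) and «separating by Hecke eigenvalues», after [Langlands1980, pp. 208–211]); §13.6 (13.6.1) p. 208, Props. 13.6.1–13.6.2
pp. 209–210, Lemma 13.6.3 p. 210; §10.3 p. 159 (`SΘ_G := Θ_G − ½ · SΘ_H`).

## WHAT THIS FILE PROVES
The kernel-checked LOGIC of the passage from the trace-formula blocks to the stabilised identity at one e.v.p. `t₀`
  «`SΘ_G(f) = 0` on the frozen family» (D1) + «`SΘ_G(f) = Σ'_t c_t · (f^S)^∧(t)`» (D2) ⟹ `Σ'_t c_t · (f^S)^∧(t) = 0` for every unramified test `f^S`;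
  the five Langlands pins on `t ↦ (f^S)^∧(t)` (D3-pins: injective, bounded, closed under `·`, `conj`, `1`) ⟹ `c_{t₀} = 0` (★ Stone–Weierstrass form
  `Literature.Topology.separation_of_injective_bounded_starClosed`); the coefficient reading `c_{t₀} = Σᶠ_i m_i · trG i φ − ½ · trH f^H` (D4) ⟹
  `Σᶠ_i m_i · trG i φ = ½ · trH f^H` —
with (D2) ASSEMBLED from `Θ_G = (discrete) + (continuous)` on the family and the three germ expansions (discrete term, continuous term, `SΘ_H(f^H)`) [Prop. 13.6.2's
bookkeeping], and (D4) ASSEMBLED from the three coefficient readings at `t₀` [line (3) p. 211; Lemma 13.6.3].  This is the content of the section's LINES file D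
(`Cruxes/H413/Lines/R90_S10_TFDecompositionD.lean` §3 `stabilisedAtEvp_of_tfDecomposition`, §4 `germExpansion_of_parts` ∕ `coeffAtT0_of_parts`, §5 `contGermExpansion_zero` ∕
`stabilisedAtEvp_of_tfBlocks₂`) RE-PROVED HERE OVER THE BLOCK BODIES — every hypothesis is the BODY of D's named `Prop` (`StableVanishingHyp`, `ThetaGPinnedHyp`,
`DiscreteGermExpansionHyp`, `ContGermExpansionHyp`, `HGermExpansionHyp`, `UnrHatPinsHyp`, `DiscreteCoeffAtT0Hyp`, `ContCoeffAtT0VanishesHyp`, `HCoeffAtT0Hyp`) token for token, and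
the conclusion is the BODY of FILE C's `StabilisedAtEvpHyp L v m Match trG trH` (`∀ fH φ, Match fH φ → ∑ᶠ i, (m i : ℂ) * trG i φ = (1 / 2 : ℂ) * trH fH`) — so that a
`Theorems`-side consumer (the S10 keystone `Theorems/R90S10StabilisedAtEvp2OfInputs.lean :: sock₂Sig_of_inputs`, which may not import LINES files) calls it BY NAME.
GENERIC in every carrier: the local test spaces `X` (`= HLoc L v → ℂ`) and `Y` (`= Gqs L v → ℂ`), the global test spaces `TG TH`, the unramified tests `Unr`, the germs `Germ`,
the distributions `thetaG sThetaH` (`= 𝔖.θG`, `𝔖.SθH` of ★ `StabilisationData`; `𝔖.SθG f fH` unfolds to `𝔖.θG f - 1 / 2 * 𝔖.SθH fH` by `rfl`), the index type `ι` of the cut.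
* §1 `coeff_eq_zero_of_unrHatPins_body` — block (D3) «separating by Hecke eigenvalues» from the five pins (★ Literature, one line).
* §2 `stabilisedAtEvp_body_of_tfDecomposition` — (D1) (D2) (D3-pins) (D4) ⟹ the identity (D §3, 8 lines).
* §3 `germExpansion_body_of_parts` — (D2) from `Θ_G = dG + contG` on the family and the three expansions, coefficients `cD + cC − ½ · cH` (D §4, termwise algebra of three
  convergent series); `coeffAtT0_body_of_parts` — (D4) from the three readings at `t₀`; `contGermExpansion_body_zero` — the continuous block at `contG = cC = 0` (D §5, `simp`).
* §4 HEADS: `stabilisedAtEvp_body_of_blocks` (general: nine named inputs `hD1 hθ hd hc hH hP hd4 hc4 hH4`); `stabilisedAtEvp_body_of_parts` (THE TWO-PLACE HEAD under ruling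
  Q-S1 — continuous term ABSENT on the two-place-cuspidal family, `hθ : Θ_G = dG` on the family; seven inputs `hD1 hθ hd hH hP hd4 hH4`); `stabilisedAtEvp_body_of_parts₀` (the same
  with `hθ` in D's verbatim shape `ThetaGPinnedHyp … dG 0`, i.e. `Θ_G(f) = dG(f) + 0 f`).
* §5 ON THE E.V.P. CURRENCY OF RECORD: `stabilisedAtEvp_body_of_parts_evp` ∕ `…_evp₀` — `Germ := {t : EigenvaluePackage S 𝓗 // bounded by bd ∧ star-fixed under σ}`,
  `Unr := {f : Π_{i∉S} 𝓗_i // {i | f i ≠ 1}.Finite}`, `hat t f := t.1.hat f.1` (D's `EvpGerm S 𝓗 bd σ` ∕ `EvpUnr S 𝓗`, spelled out), with the pins `hP` DISCHARGED by ★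
  `unrHatPins_of_restricted S 𝓗 bd σ hσ` (p862102): SIX named inputs + the unit law `hσ : σ_i 1 = 1`.
HONEST LABEL (junk test): pure bookkeeping over abstract binders — at the zero fill (`thetaG = sThetaH = 0`, all coefficients `0`, `hat ≡ 1` on `Germ = PUnit`) the hypotheses
(D1)–(D3) hold trivially and (D4) READS AS the conclusion; the file claims NO strength beyond the composition.  It pays no socket by itself: the S10 keystone instantiates it at the
two-place frozen datum and its six inputs `hD1` (S6), `hθ` (S8 (V-G)), `hd` (row 3), `hH`∕`hH4` (S5), `hd4` (row 6, ★ modulo the pin letters) are paid by their owners.  HC_CM is proved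
only modulo the 7 printed citations (2 remaining named inputs: hLiu418 = `stmt-HodgeConjecture-24832`, h413 = `stmt-HodgeConjecture-24833`) until rung 0 closes; REL ≠ ★ ≠ BUILT.
-/

set_option autoImplicit false
set_option linter.dupNamespace false

namespace Summit.HodgeConjecture.HodgeConjecture.R90.S10

open Literature.NumberTheory.Rogawski1990.Ch13Sec6

/-! ## §1 Block (D3): separating by Hecke eigenvalues from the five pins (★ Stone–Weierstrass form) -/

section Bodies

variable {ι : Type*} {X Y TG TH Unr Germ : Type*}

/-- **«SEPARATING BY HECKE EIGENVALUES» from the five pins, body currency** — if `t ↦ α t · hat t u` is summable with `Σ'_t α t · hat t u = 0` for every unramified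
test `u`, and `hat` is injective («`ψ_G` is injective on e.v.p.'s»), pointwise bounded in `t` for each test, and its test values are closed under products and complex
conjugation and contain `1`, then `α = 0`: ★ `Literature.Topology.separation_of_injective_bounded_starClosed`.  The hypothesis is the BODY of D's `UnrHatPinsHyp hat`.
[cite: Rogawski1990, §13.7 p. 211] [cite: Langlands1980, pp. 208–211] -/
theorem coeff_eq_zero_of_unrHatPins_body (hat : Germ → Unr → ℂ)
    (hP : Function.Injective hat ∧ (∀ f : Unr, ∃ C : ℝ, ∀ t : Germ, ‖hat t f‖ ≤ C) ∧ (∀ f g : Unr, ∃ h : Unr, ∀ t : Germ, hat t h = hat t f * hat t g) ∧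
      (∀ f : Unr, ∃ g : Unr, ∀ t : Germ, hat t g = (starRingEnd ℂ) (hat t f)) ∧ (∃ e : Unr, ∀ t : Germ, hat t e = 1))
    (α : Germ → ℂ) (hsum : ∀ u : Unr, Summable fun t => α t * hat t u) (hzero : ∀ u : Unr, ∑' t, α t * hat t u = 0) (t : Germ) : α t = 0 := by
  obtain ⟨hinj, hbdd, hmul, hstar, hone⟩ := hP
  exact Literature.Topology.separation_of_injective_bounded_starClosed hat hinj hbdd hmul hstar hone α hsum hzero t

/-! ## §2 (D1) (D2) (D3-pins) (D4) ⟹ the stabilised identity at `t₀` (D §3 over bodies) -/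

/-- **THE STABILISED IDENTITY AT THE E.V.P. FROM THE FOUR TRACE-FORMULA BLOCKS, body currency** — `SΘ_G(f) = Θ_G(f) − ½ · SΘ_H(f^H) = 0` on the frozen family
(D1) and its germ expansion (D2) give `Σ'_t c_t(f^H_v, φ) · (f^S)^∧(t) = 0` for all `f^S`; separating by Hecke eigenvalues (D3, from the pins) gives `c_{t₀} = 0`; the
coefficient at `t₀` (D4) is `Σᶠ_i m_i · trG i φ − ½ · trH f^H_v`, whence `Σᶠ_i m_i · trG i φ = ½ · trH f^H_v` on matched pairs — the BODY of FILE C's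
`StabilisedAtEvpHyp L v m Match trG trH` («`Σ_{ψ_G(t(π)) = t₀} m(π) Tr π(f) = ½ · Tr ρ(f^H)`», the zero-twisted slice of (13.8.3)).
[cite: Rogawski1990, §13.8 display (13.8.3) p. 218; §13.7 p. 211; §13.6 Lemma 13.6.3 (b)(c) p. 210; §10.3 p. 159] -/
theorem stabilisedAtEvp_body_of_tfDecomposition (m : ι → ℕ) (Match : X → Y → Prop) (trG : ι → Y → ℂ) (trH : X → ℂ)
    (thetaG : TG → ℂ) (sThetaH : TH → ℂ) (ΦGu : Unr → Y → TG) (ΦHu : Unr → X → TH)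
    (hat : Germ → Unr → ℂ) (coeff : Germ → X → Y → ℂ) (t₀ : Germ)
    (hD1 : ∀ (u : Unr) (fH : X) (φ : Y), Match fH φ → thetaG (ΦGu u φ) - (1 / 2 : ℂ) * sThetaH (ΦHu u fH) = 0)
    (hD2 : ∀ (u : Unr) (fH : X) (φ : Y), Match fH φ →
      (Summable fun t : Germ => coeff t fH φ * hat t u) ∧ thetaG (ΦGu u φ) - (1 / 2 : ℂ) * sThetaH (ΦHu u fH) = ∑' t : Germ, coeff t fH φ * hat t u)
    (hD3 : Function.Injective hat ∧ (∀ f : Unr, ∃ C : ℝ, ∀ t : Germ, ‖hat t f‖ ≤ C) ∧ (∀ f g : Unr, ∃ h : Unr, ∀ t : Germ, hat t h = hat t f * hat t g) ∧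
      (∀ f : Unr, ∃ g : Unr, ∀ t : Germ, hat t g = (starRingEnd ℂ) (hat t f)) ∧ (∃ e : Unr, ∀ t : Germ, hat t e = 1))
    (hD4 : ∀ (fH : X) (φ : Y), Match fH φ → coeff t₀ fH φ = ∑ᶠ i, (m i : ℂ) * trG i φ - (1 / 2 : ℂ) * trH fH) :
    ∀ (fH : X) (φ : Y), Match fH φ → ∑ᶠ i, (m i : ℂ) * trG i φ = (1 / 2 : ℂ) * trH fH := by
  intro fH φ hM
  have hzero : ∀ u : Unr, ∑' t, coeff t fH φ * hat t u = 0 := fun u => by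
    rw [← (hD2 u fH φ hM).2]
    exact hD1 u fH φ hM
  have h0 : coeff t₀ fH φ = 0 :=
    coeff_eq_zero_of_unrHatPins_body hat hD3 (fun t => coeff t fH φ) (fun u => (hD2 u fH φ hM).1) hzero t₀
  rw [hD4 fH φ hM] at h0
  linear_combination h0

/-! ## §3 (D2) and (D4) ASSEMBLED from their parts (D §4 over bodies); the continuous block at zero (D §5) -/

/-- **(D2) FROM ITS PARTS, body currency** — Prop. 13.6.2's bookkeeping «`SΘ_G(f)` is equal to the sum of the following terms»: from `Θ_G = dG + contG` on the frozen
family (`hθ`, the body of D's `ThetaGPinnedHyp`), the germ expansion of the discrete term with coefficients `cD` [(13.6.1)] (`hd`, body of `DiscreteGermExpansionHyp`), of the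
continuous (intertwining) term with coefficients `cC` [lines (5)–(7)] (`hc`, body of `ContGermExpansionHyp`) and of `SΘ_H(f^H)` with coefficients `cH` [Prop. 13.6.1] (`hH`,
body of `HGermExpansionHyp`), the germ expansion of `Θ_G(f) − ½ · SΘ_H(f^H)` with coefficients `cD + cC − ½ · cH` (termwise algebra of three convergent series).
[cite: Rogawski1990, §13.6 Prop. 13.6.2 pp. 209–210; (13.6.1) p. 208; Prop. 13.6.1 p. 209] -/
theorem germExpansion_body_of_parts (Match : X → Y → Prop) (thetaG : TG → ℂ) (sThetaH : TH → ℂ) (ΦGu : Unr → Y → TG) (ΦHu : Unr → X → TH)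
    (hat : Germ → Unr → ℂ) (dG contG : TG → ℂ) (cD cC : Germ → Y → ℂ) (cH : Germ → X → ℂ)
    (hθ : ∀ (u : Unr) (φ : Y), thetaG (ΦGu u φ) = dG (ΦGu u φ) + contG (ΦGu u φ))
    (hd : ∀ (u : Unr) (fH : X) (φ : Y), Match fH φ → (Summable fun t : Germ => cD t φ * hat t u) ∧ dG (ΦGu u φ) = ∑' t : Germ, cD t φ * hat t u)
    (hc : ∀ (u : Unr) (fH : X) (φ : Y), Match fH φ → (Summable fun t : Germ => cC t φ * hat t u) ∧ contG (ΦGu u φ) = ∑' t : Germ, cC t φ * hat t u)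
    (hH : ∀ (u : Unr) (fH : X) (φ : Y), Match fH φ → (Summable fun t : Germ => cH t fH * hat t u) ∧ sThetaH (ΦHu u fH) = ∑' t : Germ, cH t fH * hat t u) :
    ∀ (u : Unr) (fH : X) (φ : Y), Match fH φ →
      (Summable fun t : Germ => (cD t φ + cC t φ - (1 / 2 : ℂ) * cH t fH) * hat t u) ∧
        thetaG (ΦGu u φ) - (1 / 2 : ℂ) * sThetaH (ΦHu u fH) = ∑' t : Germ, (cD t φ + cC t φ - (1 / 2 : ℂ) * cH t fH) * hat t u := by
  intro u fH φ hM
  obtain ⟨hds, hde⟩ := hd u fH φ hM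
  obtain ⟨hcs, hce⟩ := hc u fH φ hM
  obtain ⟨hHs, hHe⟩ := hH u fH φ hM
  have hHs' : Summable fun t : Germ => (1 / 2 : ℂ) * (cH t fH * hat t u) := hHs.mul_left _
  have hsum : Summable fun t : Germ => cD t φ * hat t u + cC t φ * hat t u - (1 / 2 : ℂ) * (cH t fH * hat t u) := (hds.add hcs).sub hHs'
  have hrw : (fun t : Germ => (cD t φ + cC t φ - (1 / 2 : ℂ) * cH t fH) * hat t u) =
      fun t : Germ => cD t φ * hat t u + cC t φ * hat t u - (1 / 2 : ℂ) * (cH t fH * hat t u) := by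
    funext t
    ring
  refine ⟨hrw ▸ hsum, ?_⟩
  have e1 : ∑' t : Germ, (cD t φ * hat t u + cC t φ * hat t u - (1 / 2 : ℂ) * (cH t fH * hat t u)) =
      (∑' t : Germ, cD t φ * hat t u + ∑' t : Germ, cC t φ * hat t u) - ∑' t : Germ, (1 / 2 : ℂ) * (cH t fH * hat t u) := by
    rw [(hds.add hcs).tsum_sub hHs', hds.tsum_add hcs]
  have e2 : ∑' t : Germ, (1 / 2 : ℂ) * (cH t fH * hat t u) = (1 / 2 : ℂ) * ∑' t : Germ, cH t fH * hat t u := tsum_mul_left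
  rw [hrw, e1, e2, hθ u φ, hde, hce, hHe]

/-- **(D4) FROM ITS PARTS, body currency** — the coefficient of `Θ_G − ½ · SΘ_H(·^H)` at `t₀ = t(I_ρ̃′)`: the discrete reading `cD_{t₀}(φ) = Σᶠ_i m_i · trG i φ` (the cuspidal
`π` with `ψ_G(t(π)) = t₀`, second sum of line (3); `hd4`, body of D's `DiscreteCoeffAtT0Hyp`), the continuous reading `cC_{t₀}(φ) = 0` (Lemma 13.6.3 (c); `hc4`, body of
`ContCoeffAtT0VanishesHyp`) and the `H`-reading `cH_{t₀}(f^H_v) = trH f^H_v` (only `ρ` yields `t₀`, Lemma 13.6.3 (a)(b); `hH4`, body of `HCoeffAtT0Hyp`) give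
`(cD + cC − ½ · cH)_{t₀} = Σᶠ_i m_i · trG i φ − ½ · trH f^H_v` — the body of D's `CoeffAtT0Hyp` at the assembled coefficients.
[cite: Rogawski1990, §13.7 line (3) p. 211; §13.6 Lemma 13.6.3 p. 210; §13.8 display (13.8.3) p. 218] -/
theorem coeffAtT0_body_of_parts (m : ι → ℕ) (Match : X → Y → Prop) (trG : ι → Y → ℂ) (trH : X → ℂ)
    (cD cC : Germ → Y → ℂ) (cH : Germ → X → ℂ) (t₀ : Germ)
    (hd4 : ∀ (fH : X) (φ : Y), Match fH φ → cD t₀ φ = ∑ᶠ i, (m i : ℂ) * trG i φ)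
    (hc4 : ∀ (fH : X) (φ : Y), Match fH φ → cC t₀ φ = 0)
    (hH4 : ∀ (fH : X) (φ : Y), Match fH φ → cH t₀ fH = trH fH) :
    ∀ (fH : X) (φ : Y), Match fH φ → cD t₀ φ + cC t₀ φ - (1 / 2 : ℂ) * cH t₀ fH = ∑ᶠ i, (m i : ℂ) * trG i φ - (1 / 2 : ℂ) * trH fH := by
  intro fH φ hM
  rw [hd4 fH φ hM, hc4 fH φ hM, hH4 fH φ hM]
  ring

/-- **THE CONTINUOUS BLOCK AT ZERO, body currency** — with the intertwining term PINNED `contG := 0` and its coefficients `cC := 0` (ruling Q-S1: on the frozen family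
cuspidal at two archimedean places `Θ_G` IS its discrete term — Arthur's simple trace formula), the body of D's `ContGermExpansionHyp … 0 … 0` holds by `simp`.
[cite: Rogawski1990, §13.6 (13.6.1) p. 208] [cite: Arthur1988InvariantTraceFormulaII, Thm. 7.1 (a) p. 538] -/
theorem contGermExpansion_body_zero (Match : X → Y → Prop) (ΦGu : Unr → Y → TG) (hat : Germ → Unr → ℂ) :
    ∀ (u : Unr) (fH : X) (φ : Y), Match fH φ →
      (Summable fun t : Germ => (0 : Germ → Y → ℂ) t φ * hat t u) ∧ (0 : TG → ℂ) (ΦGu u φ) = ∑' t : Germ, (0 : Germ → Y → ℂ) t φ * hat t u := by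
  intro u fH φ _
  simp

/-! ## §4 THE HEADS: general (nine inputs) and two-place (seven inputs; continuous term absent under Q-S1) -/

/-- **THE HEAD OVER THE BLOCKS, body currency (general: continuous term present)** — (D1) `Θ_G(f) − ½ · SΘ_H(f^H) = 0` on the frozen family of matched pairs; `Θ_G = dG + contG`
on the family (`hθ`); the three germ expansions (`hd` discrete [(13.6.1)], `hc` continuous [lines (5)–(7)], `hH` for `SΘ_H(f^H)` [Prop. 13.6.1]); the five Langlands pins on
`hat` (`hP`); the three coefficient readings at `t₀` (`hd4` [line (3)], `hc4` [Lemma 13.6.3 (c)], `hH4` [Lemma 13.6.3 (a)(b)]) ⟹ `Σᶠ_i m_i · trG i φ = ½ · trH f^H_v` on matched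
pairs (the body of FILE C's `StabilisedAtEvpHyp L v m Match trG trH`).  Nine named inputs, each the BODY of the corresponding block of D's `stabilisedAtEvp_of_tfBlocks` with (D1)
taken family-level. [cite: Rogawski1990, §13.8 display (13.8.3) p. 218; §13.7 p. 211; §13.6 (13.6.1) p. 208, Props. 13.6.1–13.6.2 pp. 209–210, Lemma 13.6.3 p. 210] -/
theorem stabilisedAtEvp_body_of_blocks (m : ι → ℕ) (Match : X → Y → Prop) (trG : ι → Y → ℂ) (trH : X → ℂ)
    (thetaG : TG → ℂ) (sThetaH : TH → ℂ) (ΦGu : Unr → Y → TG) (ΦHu : Unr → X → TH)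
    (hat : Germ → Unr → ℂ) (dG contG : TG → ℂ) (cD cC : Germ → Y → ℂ) (cH : Germ → X → ℂ) (t₀ : Germ)
    (hD1 : ∀ (u : Unr) (fH : X) (φ : Y), Match fH φ → thetaG (ΦGu u φ) - (1 / 2 : ℂ) * sThetaH (ΦHu u fH) = 0)
    (hθ : ∀ (u : Unr) (φ : Y), thetaG (ΦGu u φ) = dG (ΦGu u φ) + contG (ΦGu u φ))
    (hd : ∀ (u : Unr) (fH : X) (φ : Y), Match fH φ → (Summable fun t : Germ => cD t φ * hat t u) ∧ dG (ΦGu u φ) = ∑' t : Germ, cD t φ * hat t u)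
    (hc : ∀ (u : Unr) (fH : X) (φ : Y), Match fH φ → (Summable fun t : Germ => cC t φ * hat t u) ∧ contG (ΦGu u φ) = ∑' t : Germ, cC t φ * hat t u)
    (hH : ∀ (u : Unr) (fH : X) (φ : Y), Match fH φ → (Summable fun t : Germ => cH t fH * hat t u) ∧ sThetaH (ΦHu u fH) = ∑' t : Germ, cH t fH * hat t u)
    (hP : Function.Injective hat ∧ (∀ f : Unr, ∃ C : ℝ, ∀ t : Germ, ‖hat t f‖ ≤ C) ∧ (∀ f g : Unr, ∃ h : Unr, ∀ t : Germ, hat t h = hat t f * hat t g) ∧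
      (∀ f : Unr, ∃ g : Unr, ∀ t : Germ, hat t g = (starRingEnd ℂ) (hat t f)) ∧ (∃ e : Unr, ∀ t : Germ, hat t e = 1))
    (hd4 : ∀ (fH : X) (φ : Y), Match fH φ → cD t₀ φ = ∑ᶠ i, (m i : ℂ) * trG i φ)
    (hc4 : ∀ (fH : X) (φ : Y), Match fH φ → cC t₀ φ = 0)
    (hH4 : ∀ (fH : X) (φ : Y), Match fH φ → cH t₀ fH = trH fH) :
    ∀ (fH : X) (φ : Y), Match fH φ → ∑ᶠ i, (m i : ℂ) * trG i φ = (1 / 2 : ℂ) * trH fH :=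
  stabilisedAtEvp_body_of_tfDecomposition m Match trG trH thetaG sThetaH ΦGu ΦHu hat (fun t fH φ => cD t φ + cC t φ - (1 / 2 : ℂ) * cH t fH) t₀ hD1
    (germExpansion_body_of_parts Match thetaG sThetaH ΦGu ΦHu hat dG contG cD cC cH hθ hd hc hH) hP
    (coeffAtT0_body_of_parts m Match trG trH cD cC cH t₀ hd4 hc4 hH4)

/-- **THE TWO-PLACE HEAD, body currency (continuous term ABSENT; `hθ` in D's verbatim shape `ThetaGPinnedHyp … dG 0`)** — as `stabilisedAtEvp_body_of_blocks` with the
intertwining term pinned `contG := 0`, `cC := 0` (ruling Q-S1: the frozen family is cuspidal at two archimedean places, so `Θ_G` is its discrete term — Arthur's simple trace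
formula; Lemma 13.6.3 (c) is NOT needed on this road): the continuous blocks `hc`, `hc4` are DISCHARGED (`contGermExpansion_body_zero`, `rfl`) and SEVEN named inputs remain —
`hD1` (two-place stabilised vanishing, S6), `hθ : Θ_G(f) = dG(f) + 0 f` on the family (S8 (V-G)), `hd` (row 3), `hH` (S5), `hP` (the pins), `hd4` (row 6), `hH4` (S5).
[cite: Rogawski1990, §13.8 display (13.8.3) p. 218; §13.7 p. 211; §13.6 Lemma 13.6.3 (b) p. 210] [cite: Arthur1988InvariantTraceFormulaII, Thm. 7.1 p. 538] -/
theorem stabilisedAtEvp_body_of_parts₀ (m : ι → ℕ) (Match : X → Y → Prop) (trG : ι → Y → ℂ) (trH : X → ℂ)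
    (thetaG : TG → ℂ) (sThetaH : TH → ℂ) (ΦGu : Unr → Y → TG) (ΦHu : Unr → X → TH)
    (hat : Germ → Unr → ℂ) (dG : TG → ℂ) (cD : Germ → Y → ℂ) (cH : Germ → X → ℂ) (t₀ : Germ)
    (hD1 : ∀ (u : Unr) (fH : X) (φ : Y), Match fH φ → thetaG (ΦGu u φ) - (1 / 2 : ℂ) * sThetaH (ΦHu u fH) = 0)
    (hθ : ∀ (u : Unr) (φ : Y), thetaG (ΦGu u φ) = dG (ΦGu u φ) + (0 : TG → ℂ) (ΦGu u φ))
    (hd : ∀ (u : Unr) (fH : X) (φ : Y), Match fH φ → (Summable fun t : Germ => cD t φ * hat t u) ∧ dG (ΦGu u φ) = ∑' t : Germ, cD t φ * hat t u)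
    (hH : ∀ (u : Unr) (fH : X) (φ : Y), Match fH φ → (Summable fun t : Germ => cH t fH * hat t u) ∧ sThetaH (ΦHu u fH) = ∑' t : Germ, cH t fH * hat t u)
    (hP : Function.Injective hat ∧ (∀ f : Unr, ∃ C : ℝ, ∀ t : Germ, ‖hat t f‖ ≤ C) ∧ (∀ f g : Unr, ∃ h : Unr, ∀ t : Germ, hat t h = hat t f * hat t g) ∧
      (∀ f : Unr, ∃ g : Unr, ∀ t : Germ, hat t g = (starRingEnd ℂ) (hat t f)) ∧ (∃ e : Unr, ∀ t : Germ, hat t e = 1))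
    (hd4 : ∀ (fH : X) (φ : Y), Match fH φ → cD t₀ φ = ∑ᶠ i, (m i : ℂ) * trG i φ)
    (hH4 : ∀ (fH : X) (φ : Y), Match fH φ → cH t₀ fH = trH fH) :
    ∀ (fH : X) (φ : Y), Match fH φ → ∑ᶠ i, (m i : ℂ) * trG i φ = (1 / 2 : ℂ) * trH fH :=
  stabilisedAtEvp_body_of_blocks m Match trG trH thetaG sThetaH ΦGu ΦHu hat dG 0 cD 0 cH t₀ hD1 hθ hd (contGermExpansion_body_zero Match ΦGu hat) hH hP
    hd4 (fun _ _ _ => rfl) hH4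

/-- **THE TWO-PLACE HEAD, body currency (continuous term ABSENT; `hθ : Θ_G = dG` on the family)** — «(13.8.3) … where the sum is over cuspidal `π` on `G` such that
`ψ_G(t(π)) = t`» on the zero slice, from SEVEN named inputs: (D1)₂ `hD1` «`Θ_G(f) − ½ · SΘ_H(f^H) = 0` on the frozen family of matched pairs» (two-place stabilised vanishing:
`f_u` stably null, `(f, f^H)` a transfer pair, `f` cuspidal at two archimedean places — payer S6); `hθ` «`Θ_G` IS its discrete term on the family» (S8 (V-G), Arthur's simple trace
formula); (D2-d) `hd` the germ expansion of the discrete term with coefficients `cD` [(13.6.1)] (row 3); (D2-H) `hH` the germ expansion of `SΘ_H(f^H)` with coefficients `cH`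
[Prop. 13.6.1] (S5); (D3-pins) `hP` the five Langlands pins on `hat` [§13.7 p. 211]; (D4-d) `hd4` the discrete coefficient at `t₀` = the weighted level-cut sum [line (3) p. 211]
(row 6); (D4-H) `hH4` the `H`-coefficient at `t₀` = `trH f^H_v` [Lemma 13.6.3 (a)(b)] (S5) ⟹ `Σᶠ_i m_i · trG i φ = ½ · trH f^H_v` on matched pairs — the BODY of FILE C's
`StabilisedAtEvpHyp L v m Match trG trH`, which the S10 keystone reads as LINES B's `Sock₂Sig 𝔣` at `m := mOf 𝔣'`, `Match := MatchE1 …`, `trG := trGPinned 𝔣'`,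
`trH := trHPinned 𝔣'`. [cite: Rogawski1990, §13.8 display (13.8.3) p. 218 L5–7; §13.7 p. 211; §13.6 (13.6.1) p. 208, Prop. 13.6.1 p. 209, Lemma 13.6.3 (a)(b) p. 210; §10.3 p. 159]
[cite: Langlands1980, pp. 208–211] [cite: Arthur1988InvariantTraceFormulaII, Thm. 7.1 p. 538] -/
theorem stabilisedAtEvp_body_of_parts (m : ι → ℕ) (Match : X → Y → Prop) (trG : ι → Y → ℂ) (trH : X → ℂ)
    (thetaG : TG → ℂ) (sThetaH : TH → ℂ) (ΦGu : Unr → Y → TG) (ΦHu : Unr → X → TH)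
    (hat : Germ → Unr → ℂ) (dG : TG → ℂ) (cD : Germ → Y → ℂ) (cH : Germ → X → ℂ) (t₀ : Germ)
    (hD1 : ∀ (u : Unr) (fH : X) (φ : Y), Match fH φ → thetaG (ΦGu u φ) - (1 / 2 : ℂ) * sThetaH (ΦHu u fH) = 0)
    (hθ : ∀ (u : Unr) (φ : Y), thetaG (ΦGu u φ) = dG (ΦGu u φ))
    (hd : ∀ (u : Unr) (fH : X) (φ : Y), Match fH φ → (Summable fun t : Germ => cD t φ * hat t u) ∧ dG (ΦGu u φ) = ∑' t : Germ, cD t φ * hat t u)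
    (hH : ∀ (u : Unr) (fH : X) (φ : Y), Match fH φ → (Summable fun t : Germ => cH t fH * hat t u) ∧ sThetaH (ΦHu u fH) = ∑' t : Germ, cH t fH * hat t u)
    (hP : Function.Injective hat ∧ (∀ f : Unr, ∃ C : ℝ, ∀ t : Germ, ‖hat t f‖ ≤ C) ∧ (∀ f g : Unr, ∃ h : Unr, ∀ t : Germ, hat t h = hat t f * hat t g) ∧
      (∀ f : Unr, ∃ g : Unr, ∀ t : Germ, hat t g = (starRingEnd ℂ) (hat t f)) ∧ (∃ e : Unr, ∀ t : Germ, hat t e = 1))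
    (hd4 : ∀ (fH : X) (φ : Y), Match fH φ → cD t₀ φ = ∑ᶠ i, (m i : ℂ) * trG i φ)
    (hH4 : ∀ (fH : X) (φ : Y), Match fH φ → cH t₀ fH = trH fH) :
    ∀ (fH : X) (φ : Y), Match fH φ → ∑ᶠ i, (m i : ℂ) * trG i φ = (1 / 2 : ℂ) * trH fH :=
  stabilisedAtEvp_body_of_parts₀ m Match trG trH thetaG sThetaH ΦGu ΦHu hat dG cD cH t₀ hD1 (fun u φ => by rw [hθ u φ, Pi.zero_apply, add_zero]) hd hH hP hd4 hH4

end Bodies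

/-! ## §5 ON THE E.V.P. CURRENCY OF RECORD — the pins DISCHARGED by ★ `unrHatPins_of_restricted` (six inputs + the unit law `hσ`) -/

section Evp

variable {ι : Type*} {X Y TG TH : Type*}

/-- **THE TWO-PLACE HEAD ON THE E.V.P. CURRENCY OF RECORD (`hθ` in D's verbatim shape)** — `stabilisedAtEvp_body_of_parts₀` with the germs PINNED to the bounded, star-fixed
e.v.p.'s `Germ := {t : EigenvaluePackage S 𝓗 // (∀ i x, ‖t i x‖ ≤ bd i x) ∧ ∀ i x, t i (σ i x) = conj (t i x)}` (the packages of UNITARY classes, §10.3 p. 159; D's `EvpGerm S 𝓗 bd σ`),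
the unramified tests PINNED to the restricted pure tensors `Unr := {f : Π_{i∉S} 𝓗_i // {i | f i ≠ 1}.Finite}` (D's `EvpUnr S 𝓗`) and `hat t f^S := (f^S)^∧(t)` (★
`EigenvaluePackage.hat`), so that the five Langlands pins (D3-pins) are DISCHARGED by ★ `unrHatPins_of_restricted S 𝓗 bd σ hσ` (p862102): SIX named inputs `hD1 hθ hd hH hd4 hH4` + the
unit law `hσ : σ_i 1 = 1` of the star pin.  `𝓗` is ANY family of unital `ℂ`-algebras (of record: the unramified Hecke algebras `HeckeQs L` off `S`).
[cite: Rogawski1990, §13.8 display (13.8.3) p. 218; §13.7 p. 211; §13.6 p. 209, Lemma 13.6.3 (b) p. 210; §10.3 p. 159] [cite: Langlands1980, pp. 208–211] -/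
theorem stabilisedAtEvp_body_of_parts_evp₀ {ιS : Type*} (S : Set ιS) (𝓗 : ιS → Type*) [∀ i, Semiring (𝓗 i)] [∀ i, Algebra ℂ (𝓗 i)]
    (bd : ∀ i : {i : ιS // i ∉ S}, 𝓗 i.1 → ℝ) (σ : ∀ i : {i : ιS // i ∉ S}, 𝓗 i.1 → 𝓗 i.1) (hσ : ∀ i, σ i 1 = 1)
    (m : ι → ℕ) (Match : X → Y → Prop) (trG : ι → Y → ℂ) (trH : X → ℂ) (thetaG : TG → ℂ) (sThetaH : TH → ℂ)
    (ΦGu : {f : ∀ i : {i : ιS // i ∉ S}, 𝓗 i.1 // {i | f i ≠ 1}.Finite} → Y → TG)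
    (ΦHu : {f : ∀ i : {i : ιS // i ∉ S}, 𝓗 i.1 // {i | f i ≠ 1}.Finite} → X → TH) (dG : TG → ℂ)
    (cD : {t : EigenvaluePackage S 𝓗 // (∀ i x, ‖t i x‖ ≤ bd i x) ∧ ∀ i x, t i (σ i x) = (starRingEnd ℂ) (t i x)} → Y → ℂ)
    (cH : {t : EigenvaluePackage S 𝓗 // (∀ i x, ‖t i x‖ ≤ bd i x) ∧ ∀ i x, t i (σ i x) = (starRingEnd ℂ) (t i x)} → X → ℂ)
    (t₀ : {t : EigenvaluePackage S 𝓗 // (∀ i x, ‖t i x‖ ≤ bd i x) ∧ ∀ i x, t i (σ i x) = (starRingEnd ℂ) (t i x)})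
    (hD1 : ∀ (u : {f : ∀ i : {i : ιS // i ∉ S}, 𝓗 i.1 // {i | f i ≠ 1}.Finite}) (fH : X) (φ : Y), Match fH φ →
      thetaG (ΦGu u φ) - (1 / 2 : ℂ) * sThetaH (ΦHu u fH) = 0)
    (hθ : ∀ (u : {f : ∀ i : {i : ιS // i ∉ S}, 𝓗 i.1 // {i | f i ≠ 1}.Finite}) (φ : Y), thetaG (ΦGu u φ) = dG (ΦGu u φ) + (0 : TG → ℂ) (ΦGu u φ))
    (hd : ∀ (u : {f : ∀ i : {i : ιS // i ∉ S}, 𝓗 i.1 // {i | f i ≠ 1}.Finite}) (fH : X) (φ : Y), Match fH φ →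
      (Summable fun t : {t : EigenvaluePackage S 𝓗 // (∀ i x, ‖t i x‖ ≤ bd i x) ∧ ∀ i x, t i (σ i x) = (starRingEnd ℂ) (t i x)} => cD t φ * t.1.hat u.1) ∧
        dG (ΦGu u φ) = ∑' t : {t : EigenvaluePackage S 𝓗 // (∀ i x, ‖t i x‖ ≤ bd i x) ∧ ∀ i x, t i (σ i x) = (starRingEnd ℂ) (t i x)}, cD t φ * t.1.hat u.1)
    (hH : ∀ (u : {f : ∀ i : {i : ιS // i ∉ S}, 𝓗 i.1 // {i | f i ≠ 1}.Finite}) (fH : X) (φ : Y), Match fH φ →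
      (Summable fun t : {t : EigenvaluePackage S 𝓗 // (∀ i x, ‖t i x‖ ≤ bd i x) ∧ ∀ i x, t i (σ i x) = (starRingEnd ℂ) (t i x)} => cH t fH * t.1.hat u.1) ∧
        sThetaH (ΦHu u fH) = ∑' t : {t : EigenvaluePackage S 𝓗 // (∀ i x, ‖t i x‖ ≤ bd i x) ∧ ∀ i x, t i (σ i x) = (starRingEnd ℂ) (t i x)}, cH t fH * t.1.hat u.1)
    (hd4 : ∀ (fH : X) (φ : Y), Match fH φ → cD t₀ φ = ∑ᶠ i, (m i : ℂ) * trG i φ)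
    (hH4 : ∀ (fH : X) (φ : Y), Match fH φ → cH t₀ fH = trH fH) :
    ∀ (fH : X) (φ : Y), Match fH φ → ∑ᶠ i, (m i : ℂ) * trG i φ = (1 / 2 : ℂ) * trH fH :=
  stabilisedAtEvp_body_of_parts₀ m Match trG trH thetaG sThetaH ΦGu ΦHu
    (fun (t : {t : EigenvaluePackage S 𝓗 // (∀ i x, ‖t i x‖ ≤ bd i x) ∧ ∀ i x, t i (σ i x) = (starRingEnd ℂ) (t i x)})
      (f : {f : ∀ i : {i : ιS // i ∉ S}, 𝓗 i.1 // {i | f i ≠ 1}.Finite}) => t.1.hat f.1)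
    dG cD cH t₀ hD1 hθ hd hH (unrHatPins_of_restricted S 𝓗 bd σ hσ) hd4 hH4

/-- **THE TWO-PLACE HEAD ON THE E.V.P. CURRENCY OF RECORD (`hθ : Θ_G = dG` on the family)** — `stabilisedAtEvp_body_of_parts` with `Germ`∕`Unr`∕`hat` PINNED to the bounded
star-fixed e.v.p.'s, the restricted pure tensors and `(f^S)^∧(t)` as in `stabilisedAtEvp_body_of_parts_evp₀`, the pins DISCHARGED by ★ `unrHatPins_of_restricted S 𝓗 bd σ hσ`:
SIX named inputs + `hσ` ⟹ «`Σ_{ψ_G(t(π)) = t₀} m(π) Tr π(f) = ½ · Tr ρ(f^H)`» on matched pairs (the body of FILE C's `StabilisedAtEvpHyp`).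
[cite: Rogawski1990, §13.8 display (13.8.3) p. 218 L5–7; §13.7 p. 211; §13.6 (13.6.1) p. 208, Prop. 13.6.1 p. 209, Lemma 13.6.3 (a)(b) p. 210; §10.3 p. 159]
[cite: Langlands1980, pp. 208–211] [cite: Arthur1988InvariantTraceFormulaII, Thm. 7.1 p. 538] -/
theorem stabilisedAtEvp_body_of_parts_evp {ιS : Type*} (S : Set ιS) (𝓗 : ιS → Type*) [∀ i, Semiring (𝓗 i)] [∀ i, Algebra ℂ (𝓗 i)]
    (bd : ∀ i : {i : ιS // i ∉ S}, 𝓗 i.1 → ℝ) (σ : ∀ i : {i : ιS // i ∉ S}, 𝓗 i.1 → 𝓗 i.1) (hσ : ∀ i, σ i 1 = 1)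
    (m : ι → ℕ) (Match : X → Y → Prop) (trG : ι → Y → ℂ) (trH : X → ℂ) (thetaG : TG → ℂ) (sThetaH : TH → ℂ)
    (ΦGu : {f : ∀ i : {i : ιS // i ∉ S}, 𝓗 i.1 // {i | f i ≠ 1}.Finite} → Y → TG)
    (ΦHu : {f : ∀ i : {i : ιS // i ∉ S}, 𝓗 i.1 // {i | f i ≠ 1}.Finite} → X → TH) (dG : TG → ℂ)
    (cD : {t : EigenvaluePackage S 𝓗 // (∀ i x, ‖t i x‖ ≤ bd i x) ∧ ∀ i x, t i (σ i x) = (starRingEnd ℂ) (t i x)} → Y → ℂ)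
    (cH : {t : EigenvaluePackage S 𝓗 // (∀ i x, ‖t i x‖ ≤ bd i x) ∧ ∀ i x, t i (σ i x) = (starRingEnd ℂ) (t i x)} → X → ℂ)
    (t₀ : {t : EigenvaluePackage S 𝓗 // (∀ i x, ‖t i x‖ ≤ bd i x) ∧ ∀ i x, t i (σ i x) = (starRingEnd ℂ) (t i x)})
    (hD1 : ∀ (u : {f : ∀ i : {i : ιS // i ∉ S}, 𝓗 i.1 // {i | f i ≠ 1}.Finite}) (fH : X) (φ : Y), Match fH φ →
      thetaG (ΦGu u φ) - (1 / 2 : ℂ) * sThetaH (ΦHu u fH) = 0)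
    (hθ : ∀ (u : {f : ∀ i : {i : ιS // i ∉ S}, 𝓗 i.1 // {i | f i ≠ 1}.Finite}) (φ : Y), thetaG (ΦGu u φ) = dG (ΦGu u φ))
    (hd : ∀ (u : {f : ∀ i : {i : ιS // i ∉ S}, 𝓗 i.1 // {i | f i ≠ 1}.Finite}) (fH : X) (φ : Y), Match fH φ →
      (Summable fun t : {t : EigenvaluePackage S 𝓗 // (∀ i x, ‖t i x‖ ≤ bd i x) ∧ ∀ i x, t i (σ i x) = (starRingEnd ℂ) (t i x)} => cD t φ * t.1.hat u.1) ∧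
        dG (ΦGu u φ) = ∑' t : {t : EigenvaluePackage S 𝓗 // (∀ i x, ‖t i x‖ ≤ bd i x) ∧ ∀ i x, t i (σ i x) = (starRingEnd ℂ) (t i x)}, cD t φ * t.1.hat u.1)
    (hH : ∀ (u : {f : ∀ i : {i : ιS // i ∉ S}, 𝓗 i.1 // {i | f i ≠ 1}.Finite}) (fH : X) (φ : Y), Match fH φ →
      (Summable fun t : {t : EigenvaluePackage S 𝓗 // (∀ i x, ‖t i x‖ ≤ bd i x) ∧ ∀ i x, t i (σ i x) = (starRingEnd ℂ) (t i x)} => cH t fH * t.1.hat u.1) ∧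
        sThetaH (ΦHu u fH) = ∑' t : {t : EigenvaluePackage S 𝓗 // (∀ i x, ‖t i x‖ ≤ bd i x) ∧ ∀ i x, t i (σ i x) = (starRingEnd ℂ) (t i x)}, cH t fH * t.1.hat u.1)
    (hd4 : ∀ (fH : X) (φ : Y), Match fH φ → cD t₀ φ = ∑ᶠ i, (m i : ℂ) * trG i φ)
    (hH4 : ∀ (fH : X) (φ : Y), Match fH φ → cH t₀ fH = trH fH) :
    ∀ (fH : X) (φ : Y), Match fH φ → ∑ᶠ i, (m i : ℂ) * trG i φ = (1 / 2 : ℂ) * trH fH :=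
  stabilisedAtEvp_body_of_parts_evp₀ S 𝓗 bd σ hσ m Match trG trH thetaG sThetaH ΦGu ΦHu dG cD cH t₀ hD1
    (fun u φ => by rw [hθ u φ, Pi.zero_apply, add_zero]) hd hH hd4 hH4

end Evp

end Summit.HodgeConjecture.HodgeConjecture.R90.S10
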